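import Summits.BirchSwinnertonDyer.BirchSwinnertonDyer.Theses.PrintX10b
import Summits.BirchSwinnertonDyer.BirchSwinnertonDyer.Theorems.PrintX10bTwoSidedLinkAnyClassNumberX10bOfPrintFactsPinnedLink
import HarnessLib

/-!
# PrintX10b rev 20, item stmt-BirchSwinnertonDyer-26624 `TwoSidedLinkAnyClassNumberX10bPinnedOfPrint`
# (the B₃ door at EVERY class number, REF-108 (B) / PIN-1 (R3)) — CLOSED by the cell's kernel turnkey T-G′(X10b)

`TwoSidedLinkAnyClassNumberX10bPinnedOfPrint := PinnedTransferPrintFacts → HeegnerPrintFactsX10b →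
TwoSidedLinkAnyClassNumberX10bPinned`: GRANTED the five printed inputs of the class-number-free pinned transfer
(Yan–Zhu 2026 Thm. 5.7 (1); Thm. 5.9 pinned, (2) ⟹ (1) at `S = {1}`, class-number-free — conjunct 2, which is
letter for letter lit g25's `YanZhu2026.bdp_mem_of_heegner_le_pinned_anyClassNumber h` for the Literature fact
`YanZhu2026.thm59_localised_pinned_anyClassNumber`, REF-111 (A) PASS, 0 flags; BCS 2025 Prop. 4.2.2; CGLS 2022
Thm. 5.1.3; Carayol) and the Heegner print bundle (conjunct 8 = JSW 2017 Thm. 3.3.1), the TIED two-sided link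
`X11b.IMCWaldspurgerOnTreeGoodAt p κ (inducedPlace ι) γ ι P` on every rank-one X10b Heegner datum with
`p ∤ c(Dt)` — no class-number split, no image hypothesis. The proof is plan g9's certified two-liner over this
seat's p608225 `CompositeTransferX10b.twoSidedLinkAnyClassNumberX10bPinned_of_printFacts_of_pinnedTransfer`
(x10b-p3 g0; the σ-bridge + pinned composite valuation at every class number).

Cell `run/shared/lean/pub/bsd-print-x9/`, seat `bsd-line-x10b-p3` (gen 2; D-0154 row 10). HONEST FRAMING: this closes a
SUPPORT item of a PRINT route (glue over named print facts; beyond-print theorem: no); the deciding crux of the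
route is the A-side `HowardContainmentAnyClassNumberX10bPinnedOfPrint` (stmt-26623, x10b-p2), untouched here;
no summit statement is proved by this seat; BSD is not proved by any of this.

References: [YanZhu2024MainConjNonCM] Thm. 5.7 (1), Thm. 5.9; [BurungaleCastellaSkinner2025] Prop. 4.2.2;
[CastellaGrossiLeeSkinner2022] Thm. 5.1.3, Prop. 4.2.1; [JetchevSkinnerWan2017] Thm. 3.3.1; [Carayol1986];
HOME plan/turnkeys/x10b-rev20/Sketch.lean (`twoSidedLinkAnyClassNumberX10bPinnedOfPrint_turnkey`).
-/

-- the summit and its single problem are both named `BirchSwinnertonDyer` (registry layout D-0017)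
set_option linter.dupNamespace false

namespace Summit.BirchSwinnertonDyer.BirchSwinnertonDyer.Theorems.PrintX10bPinned

open Summit.BirchSwinnertonDyer.BirchSwinnertonDyer.Theses.PrintX10b
open Summit.BirchSwinnertonDyer.BirchSwinnertonDyer.Cruxes.TwoSidedLinkAnyClassNumberX10b

/-- **Item stmt-BirchSwinnertonDyer-26624 `PrintX10b.TwoSidedLinkAnyClassNumberX10bPinnedOfPrint` holds**
(TURNKEY T-G′(X10b)): destructure the bundle `PinnedTransferPrintFacts` into `(h57, h59gp, h422, h513, hC)`, take
JSW Thm. 3.3.1 as conjunct 8 of `HeegnerPrintFactsX10b`, and apply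
`CompositeTransferX10b.twoSidedLinkAnyClassNumberX10bPinned_of_printFacts_of_pinnedTransfer` (p608225), whose
statement IS the pinned B₃ body on the item's binder list. Glue over named print facts; beyond-print: no.
[cite: YanZhu2024MainConjNonCM, Thm. 5.7 (1) and Thm. 5.9 (arXiv:2412.20078v4 TeX l.1217–1227, l.1283–1293)]
[cite: BurungaleCastellaSkinner2025, Prop. 4.2.2] [cite: CastellaGrossiLeeSkinner2022, Thm. 5.1.3 and Prop. 4.2.1]
[cite: JetchevSkinnerWan2017, Thm. 3.3.1] [cite: Carayol1986] -/
theorem twoSidedLinkAnyClassNumberX10bPinnedOfPrint_holds :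
    Summit.BirchSwinnertonDyer.BirchSwinnertonDyer.Theses.PrintX10b.TwoSidedLinkAnyClassNumberX10bPinnedOfPrint := by
  unfold TwoSidedLinkAnyClassNumberX10bPinnedOfPrint
  rintro ⟨h57, h59gp, h422, h513, hC⟩ hHP
  exact CompositeTransferX10b.twoSidedLinkAnyClassNumberX10bPinned_of_printFacts_of_pinnedTransfer
    h57 h59gp h422 h513 hC hHP.2.2.2.2.2.2.2.1

end Summit.BirchSwinnertonDyer.BirchSwinnertonDyer.Theorems.PrintX10bPinned
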